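import Summits.QuantumFields.YangMills.Theorems.UnitScaleTiltProp7PertVarNormGradLevelZeroT3
import Summits.QuantumFields.YangMills.Theorems.UnitScaleTiltProp7CombPullbackGradDict
import HarnessLib

/-!
# `UnitScaleTiltProp7CombCellLevelZeroCurrencyT3` — F-8c-2 OF THE (n3)-comb (II) LANE (★routeR-w1 g9 SPEC F-8 «TOP KNIT» §3 «level-0 currency», PEN-NAMER WORD 09:54:45Z «px17 g5: F-8c-2 GO»):
# **THE LEVEL-0 CELL FUNCTIONALS OF THE COMB TOWER'S BASED PULLBACKS, PRICED IN THE TARGET `hMc`'s OWN B-SLOT X-CURRENCY**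
(route `UnitScaleTilt`, crux K1 «MinimiserStabilityRegPr» stmt-QuantumFields-19200; (β) row `hMc` of ✓`Prop7HDOfCombRowRem2Rows.hD_of_hMcomb_of_rem2Rows`; def-free, count-neutral,
`--supports stmt-QuantumFields-19200 --as helper`).  Cell `ym3-torus` (HUMAN RULING D-0037, YM ladder rung R3 — YM₃ on T³ is a rung, not d = 4, not infinite volume, not a
mass gap, not Clay), width seat `ym3-torus-px17` (gen 5).

WHY.  The comb tower `Ũˡ = tildIter L U₀♯ U₁♯ l` of `hMc` lives on `ℤ³`, on the BASED PULLBACKS `U₀♯ := pull (bgUnits F K W) y`, `U₁♯ := pull (b ↦ expUnit (iX b)) y`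
(`y = basePt F n K`); the cell-level theorem F-8b bounds `Σ_{cell_l}‖Ũˡ − 1‖²` by `A′·M₀·L^{−l} + (B′·GRADcov₀ + B″·(Lᵏ)⁻²·M₀)·Lˡ` with the LEVEL-0 CELL FUNCTIONALS
`M₀ = Σ_{t}Σ_μ ‖X♯(t,μ)‖²` and `GRADcov₀ = Σ_{t}Σ_μΣ_ν ‖R(U₀♯(t,ν))Y₀(t+e_ν,μ) − Y₀(t,μ)‖²` (`Y₀ = Ũ⁰ − 1 = U₁♯ − 1`), while the target `hMc` is priced on the TORUS in
`Σ_b‖X b‖²`, the plaquette form `K_W(iX)` and `DIV_W(iX)`.  ★routeR-w1's F-8c-1 ✓`Prop7CombPullbackGradDict` is the dictionary (cell sums of based pullbacks ARE torus sums; the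
cell covariant-gradient energy IS the left side of the Weitzenböck row ✓`Prop7CovIterLambdaHLambdaBridge.sum_normSq_covGrad_le_curl_divB`, read for a field `Y` in `Y`-letters).
THIS FILE does the X-CURRENCY step at level 0: the tower's level-0 field is `Y₀ = e^{iX} − 1 = pertVar W (e^{iX}W)` (pulled back), NOT `iX`; its curl∕divergence∕mass are exchanged
to `K_W(iX)`, `DIV_W(iX)`, `Σ_b‖X b‖²` by the landed rows of ✓`Prop7PertVarCurrencyExchange` (`curlHS_pertVar_le_plaqK`, `divHS_pertVar_le`, `sum_normSq_pertVar_le`) — the SAME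
four-row chain px13's ✓`Prop7PertVarNormGradLevelZeroT3.sum_sq_norm_sub_norm_pertVar_le_plaqK` uses, without its norm-field step.

WHAT IS PROVED (ns `…Theorems.Prop7CombCellLevelZeroCurrencyT3`; sorry-free):
* §1 (generic torus `P`, rank `N`) ★`sum_normSq_covGrad_pertVar_le_plaqK` — `Σ_bΣ_ν‖U₀Y(b+e_ν)U₀⋆ − Y(b)‖² ≤ 4N·K_{U₀}(iX) + 2·DIV_HS(iX) + (N·d·(64a²+8s²) + 2N·d·s² + 2d·a·N)·Σ_b‖X b‖²`
  for `Y = pertVar U₀ (e^{iX}U₀)`, `‖X b‖ ≤ s`, plaquettes within `a` (the covariant-gradient twin of px13's norm-field row);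
* §2 (the T³ member, level 0, `hMc`'s letters; cell sockets = F-8c-1's `Σ_t Σ_μ Σ_ν` shape, any base `y`, any name `N₀` of the level-0 site count) `coe_pull_expUnit_sub_one`
  (`↑U₁♯ − 1 = (pertVar W (e^{iX}W))♯`), `cellMass_I_smul_X_eq_T3` (`M₀` of `(iX)♯` `= Σ_b‖X b‖²`), `cellMass_Y0_le_T3` (`Σ_tΣ_μ‖Y₀‖² ≤ Σ_b‖X b‖²`),
  ★★`cellGrad_Y0_le_of_regPr_T3` — `GRADcov₀(Y₀) ≤ 8·K_W(iX) + 2·DIV_W(iX) + (384a² + 60s² + 12a)·Σ_b‖X b‖²`, `a = ε·((L^{K−n})²)⁻¹`, under `RegPr F n K ε W`, `X` Hermitian traceless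
  with `‖X b‖ ≤ s` — `K_W(iX)`, `DIV_W(iX)` TOKEN FOR TOKEN the two sums of `hMc`'s B-slot; its `tildIter … 0` edition ★★`cellGrad_tildIter_zero_le_of_regPr_T3` (`hMc`'s own tower
  letter at `l = 0` = ★routeR-w1 F-7a's `Yt 0`); and the ν-OUTER twins `cellGrad_Y0_le_of_regPr_T3_comm` ∕ `cellGrad_tildIter_zero_le_of_regPr_T3_comm` (★routeR-w6 F-6d-3's `GRADc 0`
  summation order);
* §3 (AT THE `hMc` DATUM) `eta_sq_eq`, `inv_ell_sq_le_one`, ★★`cellGrad_Y0_le_of_regPr_of_in19_T3` ∕ ★★`cellGrad_tildIter_zero_le_of_regPr_of_in19_T3` — windows read off `In19 F n K δ W U₁ X`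
  (Hermitian traceless, `‖X b‖ < δη`) and `RegPr F n K ε W`: `GRADcov₀ ≤ 8·K_W(iX) + 2·DIV_W(iX) + (384ε² + 12ε + 60δ²)·((L^{K−n})²)⁻¹·Σ_b‖X b‖²` — the whole zeroth-order
  part in `hMc`'s `B′·((L^{K−n})²)⁻¹·M` slot; `cellMass_Y0_le_of_in19_T3`.
HONEST FRAMING.  A recombination of landed rows + F-8c-1's dictionary (S–M); no level recursion (F-7c), no ℓ² rows (F-7b), no Σ-over-corners (F-6d), no top knit (F-8b∕F-8c-final);
nothing of `hMcomb`∕`hMcomb₂`∕(β)∕hPA2∕hcoS∕E′∕EX∕the crux is proved; rung R3, not Clay; the YM mass gap is NOT proved.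
References: T. Bałaban, CMP 102 (1985) 277–309 [Balaban1985Variational] ((2) p.278, (15) p.280, (19) p.281, (47)–(48) pp.285–286, (135) p.298); CMP 99 (1985) 389–434
[Balaban1985BackgroundPropagators] ((3.4)–(3.8) pp.391–392); CMP 98 (1985) 17–51 [Balaban1985Averaging] ((9) p.18, (24) p.21, (56) p.27, (69) p.29); CMP 99 (1985)
75–102 [Balaban1985RegularSpaces] ((1.1)–(1.3) pp.76–77).
-/

set_option autoImplicit false

noncomputable section

open scoped BigOperators Matrix.Norms.L2Operator

namespace Summit.QuantumFields.YangMills.Theorems.Prop7CombCellLevelZeroCurrencyT3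

open Finset NormedSpace
open Literature.MathematicalPhysics.QuantumFieldTheory.Balaban1983to89
open Literature.MathematicalPhysics.QuantumFieldTheory.Balaban1983to89.T3ContinuumYM3Torus
open T4Continuum BlockAveraging BlockAveragingEMLLinearisedBackground
open T3PrintedRegularMinimiser (RegPr)
open T3SectALandauChart (emb15 bgUnits eta eta_pos In19)
open B7Prop1Explicit renaming Site → LSite
open B7Prop1Explicit (e boxVec expUnit val_expUnit)
open B7Eq78Linearization (conjR)
open B7Eq92Concrete (tildIter tildIter_zero')
open B9Eq39Adjoint (curl divB)
open B9TorusCalculus (torusT)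
open B10Eq27TorusAxialLog (transl pull pull_apply unitsField toUField)
open Summit.QuantumFields.YangMills.Theorems.Prop7TPrint (expHermField)
open Summit.QuantumFields.YangMills.Theorems.Prop7CovIterLambdaHLambdaBridge (sum_normSq_covGrad_le_curl_divB)
open Summit.QuantumFields.YangMills.Theorems.Prop7CombPullbackGradDict (sum_cell_normSq_covGrad_pull_eq sum_cell_normSq_pull_eq)
open Summit.QuantumFields.YangMills.Theorems.Prop7PertVarCurrencyExchange (pertVar_eq_exp_sub_one norm_pertVar_le curlHS_pertVar_le_plaqK divHS_pertVar_le
  sum_normSq_pertVar_le)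
open Summit.QuantumFields.YangMills.Theorems.Prop7TwistedLevelMassOfRegPr (plaq_le_of_regPr)
open Summit.QuantumFields.YangMills.Theorems.Prop7FrameRem2RowZeroT3 (coe_emb15_expHermField_apply)

/-! ## §1 ★ The covariant gradient of `pertVar` in X-letters (generic torus, rank `N`) -/

section PertVar

variable {P : Params} {N : ℕ} [NeZero N] {i : ℕ}

/-- ★ **`Y = pertVar U₀ U`, `U = e^{iX}U₀`** (`X` Hermitian, `‖X b‖ ≤ s`, plaquettes of `U₀` within `a`):
`Σ_bΣ_ν ‖U₀(b.src,ν)·Y(b+e_ν)·U₀(b.src,ν)⋆ − Y(b)‖² ≤ 4N·K_{U₀}(iX) + 2·DIV_HS(iX) + (N·d·(64a² + 8s²) + 2N·d·s² + 2d·a·N)·Σ_b‖X b‖²` — the covariant-gradient twin of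
✓`Prop7PertVarNormGradLevelZeroT3.sum_sq_norm_sub_norm_pertVar_le_plaqK` (Weitzenböck ✓`sum_normSq_covGrad_le_curl_divB` ∘ ✓`curlHS_pertVar_le_plaqK` ∘ ✓`divHS_pertVar_le` ∘
✓`sum_normSq_pertVar_le`). [cite: Balaban1985Variational, (15) p.280, (47)-(48) pp.285-286, (135) p.298; Balaban1985BackgroundPropagators, (3.4)-(3.8) pp.391-392] -/
theorem sum_normSq_covGrad_pertVar_le_plaqK (U₀ U : GaugeField P i (Matrix.specialUnitaryGroup (Fin N) ℂ)) (X : PBond P i → Matrix (Fin N) (Fin N) ℂ)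
    (hX : ∀ b, (X b).IsHermitian)
    (hUX : ∀ b, ((U b : Matrix.specialUnitaryGroup (Fin N) ℂ) : Matrix (Fin N) (Fin N) ℂ)
      = exp (Complex.I • X b) * ((U₀ b : Matrix.specialUnitaryGroup (Fin N) ℂ) : Matrix (Fin N) (Fin N) ℂ))
    {s : ℝ} (hs : ∀ b, ‖X b‖ ≤ s) {a : ℝ} (ha : 0 ≤ a) (hU : ∀ p : Plaq P i, dist1 (GaugeField.plaqHol U₀ p) ≤ a) :
    ∑ b : PBond P i, ∑ ν : Fin P.d,
        ‖((U₀ ⟨b.src, ν⟩ : Matrix.specialUnitaryGroup (Fin N) ℂ) : Matrix (Fin N) (Fin N) ℂ) * pertVar U₀ U ⟨b.src.shift ν, b.dir⟩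
            * star ((U₀ ⟨b.src, ν⟩ : Matrix.specialUnitaryGroup (Fin N) ℂ) : Matrix (Fin N) (Fin N) ℂ) - pertVar U₀ U b‖ ^ 2
      ≤ 4 * N * (∑ p : Plaq P i, ‖((Complex.I • X ⟨p.src, p.μ⟩)
          + ((U₀ ⟨p.src, p.μ⟩ : Matrix (Fin N) (Fin N) ℂ) * (Complex.I • X ⟨p.src.shift p.μ, p.ν⟩) * star (U₀ ⟨p.src, p.μ⟩ : Matrix (Fin N) (Fin N) ℂ))
          - (((U₀ ⟨p.src, p.μ⟩ * U₀ ⟨p.src.shift p.μ, p.ν⟩ * (U₀ ⟨p.src.shift p.ν, p.μ⟩)⁻¹ : Matrix.specialUnitaryGroup (Fin N) ℂ) : Matrix (Fin N) (Fin N) ℂ)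
              * (Complex.I • X ⟨p.src.shift p.ν, p.μ⟩)
              * star ((U₀ ⟨p.src, p.μ⟩ * U₀ ⟨p.src.shift p.μ, p.ν⟩ * (U₀ ⟨p.src.shift p.ν, p.μ⟩)⁻¹ : Matrix.specialUnitaryGroup (Fin N) ℂ) : Matrix (Fin N) (Fin N) ℂ))
          - (((GaugeField.plaqHol U₀ p : Matrix.specialUnitaryGroup (Fin N) ℂ) : Matrix (Fin N) (Fin N) ℂ) * (Complex.I • X ⟨p.src, p.ν⟩)
              * star ((GaugeField.plaqHol U₀ p : Matrix.specialUnitaryGroup (Fin N) ℂ) : Matrix (Fin N) (Fin N) ℂ)))‖ ^ 2)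
        + 2 * ∑ x : Site P i, ∑ j : Fin N, ∑ k : Fin N,
            ‖(divB (torusT P i) (fun κ z => unitsField (toUField U₀) ⟨z, κ⟩) (fun κ z => Complex.I • X ⟨z, κ⟩) x) j k‖ ^ 2
        + (N * P.d * (64 * a ^ 2 + 8 * s ^ 2) + 2 * N * P.d * s ^ 2 + 2 * P.d * a * N) * ∑ b : PBond P i, ‖X b‖ ^ 2 := by
  have h1 := sum_normSq_covGrad_le_curl_divB U₀ ha hU (pertVar U₀ U)
  have h2 := curlHS_pertVar_le_plaqK U₀ U X hX hUX hs hU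
  have h3 := divHS_pertVar_le U₀ U X hX hUX hs
  have h4 := sum_normSq_pertVar_le U₀ U X hX hUX
  have hM : 0 ≤ ∑ b : PBond P i, ‖X b‖ ^ 2 := Finset.sum_nonneg fun _ _ => sq_nonneg _
  have hdaN : (0 : ℝ) ≤ 2 * P.d * a * N := by positivity
  have h5 := mul_le_mul_of_nonneg_left h4 hdaN
  nlinarith [h1, h2, h3, h5, hM]

end PertVar

/-! ## §2 ★★ The T³ member at level 0, in `hMc`'s letters (cell sockets = F-8c-1's shape) -/

section T3

variable (F : T3Family) (n K : ℕ)

/-- **THE LEVEL-0 COMB DATUM IS THE PULLED PERTURBATION VARIABLE**: `↑(U₁♯(z,μ)) − 1 = (pertVar W (e^{iX}W))(x₀ + z, μ)` for `U₁♯ = pull (b ↦ expUnit (iX b)) x₀`, `X` Hermitian traceless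
(lit ✓`val_expUnit`, ✓`pertVar_eq_exp_sub_one`, ✓`coe_emb15_expHermField_apply`). [cite: Balaban1985Variational, (15) p.280, (19) p.281; Balaban1985Averaging, (69) p.29] -/
theorem coe_pull_expUnit_sub_one (W : GaugeField (F.P K) 0 (Matrix.specialUnitaryGroup (Fin 2) ℂ)) (X : PBond (F.P K) 0 → Matrix (Fin 2) (Fin 2) ℂ)
    (hX : ∀ b : PBond (F.P K) 0, (X b).IsHermitian ∧ Matrix.trace (X b) = 0) (y : Site (F.P K) 0) (z : LSite (F.P K).d) (μ : Fin (F.P K).d) :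
    ((pull (fun b => expUnit (Complex.I • X b)) y z μ : (Matrix (Fin 2) (Fin 2) ℂ)ˣ) : Matrix (Fin 2) (Fin 2) ℂ) - 1
      = pull (pertVar W (emb15 W (expHermField X))) y z μ := by
  rw [pull_apply, pull_apply, val_expUnit, pertVar_eq_exp_sub_one W (emb15 W (expHermField X)) X (coe_emb15_expHermField_apply F W X hX)]

/-- **`M₀` OF `(iX)♯ = pull (b ↦ I • X b) y` IN THE TARGET's CURRENCY**: `Σ_{t}Σ_μ ‖(iX)♯(boxVec N₀ t, μ)‖² = Σ_b ‖X b‖²` (F-8c-1 ✓`sum_cell_normSq_pull_eq` + `‖iX‖ = ‖X‖`; for `X♯` itself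
F-8c-1's lemma is the statement). [cite: Balaban1985Variational, (19) p.281; Balaban1985RegularSpaces, (1.3) p.77] -/
theorem cellMass_I_smul_X_eq_T3 {N₀ : ℕ} (hN : (F.P K).sitesPerDir 0 = N₀) (y : Site (F.P K) 0) (X : PBond (F.P K) 0 → Matrix (Fin 2) (Fin 2) ℂ) :
    ∑ t : Fin (F.P K).d → Fin N₀, ∑ μ : Fin (F.P K).d, ‖pull (fun b => Complex.I • X b) y (boxVec N₀ t) μ‖ ^ 2 = ∑ b : PBond (F.P K) 0, ‖X b‖ ^ 2 := by
  rw [sum_cell_normSq_pull_eq F K hN (fun b => Complex.I • X b) y]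
  exact Finset.sum_congr rfl fun b _ => by rw [norm_smul, Complex.norm_I, one_mul]

/-- **THE CELL MASS OF `Y₀ = U₁♯ − 1` IS AT MOST `Σ_b‖X b‖²`** (`‖e^{iX} − 1‖ ≤ ‖X‖` for Hermitian `X`, ✓`norm_pertVar_le`). [cite: Balaban1985Averaging, (24) p.21; Balaban1985Variational, (15) p.280] -/
theorem cellMass_Y0_le_T3 {N₀ : ℕ} (hN : (F.P K).sitesPerDir 0 = N₀) (y : Site (F.P K) 0) (W : GaugeField (F.P K) 0 (Matrix.specialUnitaryGroup (Fin 2) ℂ))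
    (X : PBond (F.P K) 0 → Matrix (Fin 2) (Fin 2) ℂ) (hX : ∀ b : PBond (F.P K) 0, (X b).IsHermitian ∧ Matrix.trace (X b) = 0) :
    ∑ t : Fin (F.P K).d → Fin N₀, ∑ μ : Fin (F.P K).d,
        ‖((pull (fun b => expUnit (Complex.I • X b)) y (boxVec N₀ t) μ : (Matrix (Fin 2) (Fin 2) ℂ)ˣ) : Matrix (Fin 2) (Fin 2) ℂ) - 1‖ ^ 2
      ≤ ∑ b : PBond (F.P K) 0, ‖X b‖ ^ 2 := by
  simp only [coe_pull_expUnit_sub_one F K W X hX]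
  rw [sum_cell_normSq_pull_eq F K hN (pertVar W (emb15 W (expHermField X))) y]
  exact sum_normSq_pertVar_le W (emb15 W (expHermField X)) X (fun b => (hX b).1) (coe_emb15_expHermField_apply F W X hX)

/-- ★★ **`GRADcov₀` (SPEC F-8b's B-SLOT INPUT) IN THE TARGET's CURRENCY — THE MEMBER AT LEVEL 0.**  For `W ∈ 𝔘_k(e)` (`RegPr F n K ε W`, `0 ≤ ε`), `X` Hermitian traceless with
`‖X b‖ ≤ s`, the based pullbacks `U₀♯ = pull (bgUnits F K W) y`, `U₁♯ = pull (b ↦ expUnit (iX b)) y` (any base `y`, e.g. `basePt F n K`; any name `N₀` of the level-0 site count)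
and `Y₀ = ↑U₁♯ − 1`:
`Σ_{t}Σ_μΣ_ν ‖R(U₀♯(t,ν)) Y₀(t+e_ν,μ) − Y₀(t,μ)‖² ≤ 8·K_W(iX) + 2·DIV_W(iX) + (384a² + 60s² + 12a)·Σ_b‖X b‖²`, `a = ε·((L^{K−n})²)⁻¹`, with `K_W(iX)` and `DIV_W(iX)` the two torus sums of
`hMc`'s B-slot verbatim (cell socket = F-8c-1 ✓`sum_cell_normSq_covGrad_pull_eq`'s `Σ_t Σ_μ Σ_ν` shape; §1 at `N = 2`, `d = 3`, ✓`plaq_le_of_regPr`). [cite: Balaban1985Variational, (2) p.278, (15) p.280, (47)-(48) pp.285-286, (135) p.298;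
Balaban1985BackgroundPropagators, (3.4)-(3.8) pp.391-392] -/
theorem cellGrad_Y0_le_of_regPr_T3 {N₀ : ℕ} (hN : (F.P K).sitesPerDir 0 = N₀) (y : Site (F.P K) 0) {ε s : ℝ} (hε : 0 ≤ ε)
    {W : GaugeField (F.P K) 0 (Matrix.specialUnitaryGroup (Fin 2) ℂ)} (hreg : RegPr F n K ε W)
    (X : PBond (F.P K) 0 → Matrix (Fin 2) (Fin 2) ℂ) (hX : ∀ b : PBond (F.P K) 0, (X b).IsHermitian ∧ Matrix.trace (X b) = 0)
    (hs : ∀ b : PBond (F.P K) 0, ‖X b‖ ≤ s) :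
    ∑ t : Fin (F.P K).d → Fin N₀, ∑ μ : Fin (F.P K).d, ∑ ν : Fin (F.P K).d,
        ‖conjR (pull (bgUnits F K W) y (boxVec N₀ t) ν)
            (((pull (fun b => expUnit (Complex.I • X b)) y (boxVec N₀ t + e ν) μ : (Matrix (Fin 2) (Fin 2) ℂ)ˣ) : Matrix (Fin 2) (Fin 2) ℂ) - 1)
          - (((pull (fun b => expUnit (Complex.I • X b)) y (boxVec N₀ t) μ : (Matrix (Fin 2) (Fin 2) ℂ)ˣ) : Matrix (Fin 2) (Fin 2) ℂ) - 1)‖ ^ 2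
      ≤ 8 * (∑ p : Plaq (F.P K) 0, ‖((Complex.I • X ⟨p.src, p.μ⟩)
          + ((W ⟨p.src, p.μ⟩ : Matrix (Fin 2) (Fin 2) ℂ) * (Complex.I • X ⟨p.src.shift p.μ, p.ν⟩) * star (W ⟨p.src, p.μ⟩ : Matrix (Fin 2) (Fin 2) ℂ))
          - (((W ⟨p.src, p.μ⟩ * W ⟨p.src.shift p.μ, p.ν⟩ * (W ⟨p.src.shift p.ν, p.μ⟩)⁻¹ : Matrix.specialUnitaryGroup (Fin 2) ℂ) : Matrix (Fin 2) (Fin 2) ℂ)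
              * (Complex.I • X ⟨p.src.shift p.ν, p.μ⟩)
              * star ((W ⟨p.src, p.μ⟩ * W ⟨p.src.shift p.μ, p.ν⟩ * (W ⟨p.src.shift p.ν, p.μ⟩)⁻¹ : Matrix.specialUnitaryGroup (Fin 2) ℂ) : Matrix (Fin 2) (Fin 2) ℂ))
          - (((GaugeField.plaqHol W p : Matrix.specialUnitaryGroup (Fin 2) ℂ) : Matrix (Fin 2) (Fin 2) ℂ) * (Complex.I • X ⟨p.src, p.ν⟩)
              * star ((GaugeField.plaqHol W p : Matrix.specialUnitaryGroup (Fin 2) ℂ) : Matrix (Fin 2) (Fin 2) ℂ)))‖ ^ 2)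
        + 2 * ∑ x : Site (F.P K) 0, ∑ j : Fin 2, ∑ k : Fin 2,
            ‖(divB (torusT (F.P K) 0) (fun κ z => unitsField (toUField W) ⟨z, κ⟩) (fun κ z => Complex.I • X ⟨z, κ⟩) x) j k‖ ^ 2
        + (384 * (ε * (((F.L : ℝ) ^ (K - n)) ^ 2)⁻¹) ^ 2 + 60 * s ^ 2 + 12 * (ε * (((F.L : ℝ) ^ (K - n)) ^ 2)⁻¹)) * ∑ b : PBond (F.P K) 0, ‖X b‖ ^ 2 := by
  simp only [coe_pull_expUnit_sub_one F K W X hX]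
  rw [sum_cell_normSq_covGrad_pull_eq F K hN W (pertVar W (emb15 W (expHermField X))) y]
  have ha : 0 ≤ ε * (((F.L : ℝ) ^ (K - n)) ^ 2)⁻¹ := by positivity
  have h := sum_normSq_covGrad_pertVar_le_plaqK W (emb15 W (expHermField X)) X (fun b => (hX b).1)
    (coe_emb15_expHermField_apply F W X hX) hs ha (plaq_le_of_regPr F n K hreg)
  have hd : ((F.P K).d : ℝ) = 3 := by rw [T3Family.P_d]; norm_num
  simp only [hd, Nat.cast_ofNat] at h
  have hM : 0 ≤ ∑ b : PBond (F.P K) 0, ‖X b‖ ^ 2 := Finset.sum_nonneg fun _ _ => sq_nonneg _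
  nlinarith [h, hM]

/-- ★★ **THE SAME IN `hMc`'s OWN TOWER LETTER AT LEVEL 0** (`Ũ⁰ = tildIter L U₀♯ U₁♯ 0 = U₁♯`, lit ✓`tildIter_zero'`): the cell covariant-gradient energy of `Ỹ_0 = Ũ⁰ − 1` (★routeR-w1 F-7a's
`Yt 0`) w.r.t. `U₀♯` is `≤ 8·K_W(iX) + 2·DIV_W(iX) + (384a² + 60s² + 12a)·Σ_b‖X b‖²`. [cite: Balaban1985Averaging, (69) p.29; Balaban1985Variational, (2) p.278,
(15) p.280, (47)-(48) pp.285-286, (135) p.298] -/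
theorem cellGrad_tildIter_zero_le_of_regPr_T3 {N₀ : ℕ} (hN : (F.P K).sitesPerDir 0 = N₀) (y : Site (F.P K) 0) {ε s : ℝ} (hε : 0 ≤ ε)
    {W : GaugeField (F.P K) 0 (Matrix.specialUnitaryGroup (Fin 2) ℂ)} (hreg : RegPr F n K ε W)
    (X : PBond (F.P K) 0 → Matrix (Fin 2) (Fin 2) ℂ) (hX : ∀ b : PBond (F.P K) 0, (X b).IsHermitian ∧ Matrix.trace (X b) = 0)
    (hs : ∀ b : PBond (F.P K) 0, ‖X b‖ ≤ s) :
    ∑ t : Fin (F.P K).d → Fin N₀, ∑ μ : Fin (F.P K).d, ∑ ν : Fin (F.P K).d,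
        ‖conjR (pull (bgUnits F K W) y (boxVec N₀ t) ν)
            (((tildIter (F.P K).L (pull (bgUnits F K W) y) (pull (fun b => expUnit (Complex.I • X b)) y) 0 (boxVec N₀ t + e ν) μ
                : (Matrix (Fin 2) (Fin 2) ℂ)ˣ) : Matrix (Fin 2) (Fin 2) ℂ) - 1)
          - (((tildIter (F.P K).L (pull (bgUnits F K W) y) (pull (fun b => expUnit (Complex.I • X b)) y) 0 (boxVec N₀ t) μ
                : (Matrix (Fin 2) (Fin 2) ℂ)ˣ) : Matrix (Fin 2) (Fin 2) ℂ) - 1)‖ ^ 2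
      ≤ 8 * (∑ p : Plaq (F.P K) 0, ‖((Complex.I • X ⟨p.src, p.μ⟩)
          + ((W ⟨p.src, p.μ⟩ : Matrix (Fin 2) (Fin 2) ℂ) * (Complex.I • X ⟨p.src.shift p.μ, p.ν⟩) * star (W ⟨p.src, p.μ⟩ : Matrix (Fin 2) (Fin 2) ℂ))
          - (((W ⟨p.src, p.μ⟩ * W ⟨p.src.shift p.μ, p.ν⟩ * (W ⟨p.src.shift p.ν, p.μ⟩)⁻¹ : Matrix.specialUnitaryGroup (Fin 2) ℂ) : Matrix (Fin 2) (Fin 2) ℂ)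
              * (Complex.I • X ⟨p.src.shift p.ν, p.μ⟩)
              * star ((W ⟨p.src, p.μ⟩ * W ⟨p.src.shift p.μ, p.ν⟩ * (W ⟨p.src.shift p.ν, p.μ⟩)⁻¹ : Matrix.specialUnitaryGroup (Fin 2) ℂ) : Matrix (Fin 2) (Fin 2) ℂ))
          - (((GaugeField.plaqHol W p : Matrix.specialUnitaryGroup (Fin 2) ℂ) : Matrix (Fin 2) (Fin 2) ℂ) * (Complex.I • X ⟨p.src, p.ν⟩)
              * star ((GaugeField.plaqHol W p : Matrix.specialUnitaryGroup (Fin 2) ℂ) : Matrix (Fin 2) (Fin 2) ℂ)))‖ ^ 2)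
        + 2 * ∑ x : Site (F.P K) 0, ∑ j : Fin 2, ∑ k : Fin 2,
            ‖(divB (torusT (F.P K) 0) (fun κ z => unitsField (toUField W) ⟨z, κ⟩) (fun κ z => Complex.I • X ⟨z, κ⟩) x) j k‖ ^ 2
        + (384 * (ε * (((F.L : ℝ) ^ (K - n)) ^ 2)⁻¹) ^ 2 + 60 * s ^ 2 + 12 * (ε * (((F.L : ℝ) ^ (K - n)) ^ 2)⁻¹)) * ∑ b : PBond (F.P K) 0, ‖X b‖ ^ 2 := by
  simp only [tildIter_zero']
  exact cellGrad_Y0_le_of_regPr_T3 F n K hN y hε hreg X hX hs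

/-- The ν-OUTER edition of `cellGrad_Y0_le_of_regPr_T3` (★routeR-w6 F-6d-3's `GRADc 0` summation order `Σ_t Σ_ν Σ_μ`; `Finset.sum_comm`). [cite: Balaban1985Variational, (135) p.298;
Balaban1985RegularSpaces, (1.1)-(1.3) pp.76-77] -/
theorem cellGrad_Y0_le_of_regPr_T3_comm {N₀ : ℕ} (hN : (F.P K).sitesPerDir 0 = N₀) (y : Site (F.P K) 0) {ε s : ℝ} (hε : 0 ≤ ε)
    {W : GaugeField (F.P K) 0 (Matrix.specialUnitaryGroup (Fin 2) ℂ)} (hreg : RegPr F n K ε W)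
    (X : PBond (F.P K) 0 → Matrix (Fin 2) (Fin 2) ℂ) (hX : ∀ b : PBond (F.P K) 0, (X b).IsHermitian ∧ Matrix.trace (X b) = 0)
    (hs : ∀ b : PBond (F.P K) 0, ‖X b‖ ≤ s) :
    ∑ t : Fin (F.P K).d → Fin N₀, ∑ ν : Fin (F.P K).d, ∑ μ : Fin (F.P K).d,
        ‖conjR (pull (bgUnits F K W) y (boxVec N₀ t) ν)
            (((pull (fun b => expUnit (Complex.I • X b)) y (boxVec N₀ t + e ν) μ : (Matrix (Fin 2) (Fin 2) ℂ)ˣ) : Matrix (Fin 2) (Fin 2) ℂ) - 1)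
          - (((pull (fun b => expUnit (Complex.I • X b)) y (boxVec N₀ t) μ : (Matrix (Fin 2) (Fin 2) ℂ)ˣ) : Matrix (Fin 2) (Fin 2) ℂ) - 1)‖ ^ 2
      ≤ 8 * (∑ p : Plaq (F.P K) 0, ‖((Complex.I • X ⟨p.src, p.μ⟩)
          + ((W ⟨p.src, p.μ⟩ : Matrix (Fin 2) (Fin 2) ℂ) * (Complex.I • X ⟨p.src.shift p.μ, p.ν⟩) * star (W ⟨p.src, p.μ⟩ : Matrix (Fin 2) (Fin 2) ℂ))
          - (((W ⟨p.src, p.μ⟩ * W ⟨p.src.shift p.μ, p.ν⟩ * (W ⟨p.src.shift p.ν, p.μ⟩)⁻¹ : Matrix.specialUnitaryGroup (Fin 2) ℂ) : Matrix (Fin 2) (Fin 2) ℂ)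
              * (Complex.I • X ⟨p.src.shift p.ν, p.μ⟩)
              * star ((W ⟨p.src, p.μ⟩ * W ⟨p.src.shift p.μ, p.ν⟩ * (W ⟨p.src.shift p.ν, p.μ⟩)⁻¹ : Matrix.specialUnitaryGroup (Fin 2) ℂ) : Matrix (Fin 2) (Fin 2) ℂ))
          - (((GaugeField.plaqHol W p : Matrix.specialUnitaryGroup (Fin 2) ℂ) : Matrix (Fin 2) (Fin 2) ℂ) * (Complex.I • X ⟨p.src, p.ν⟩)
              * star ((GaugeField.plaqHol W p : Matrix.specialUnitaryGroup (Fin 2) ℂ) : Matrix (Fin 2) (Fin 2) ℂ)))‖ ^ 2)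
        + 2 * ∑ x : Site (F.P K) 0, ∑ j : Fin 2, ∑ k : Fin 2,
            ‖(divB (torusT (F.P K) 0) (fun κ z => unitsField (toUField W) ⟨z, κ⟩) (fun κ z => Complex.I • X ⟨z, κ⟩) x) j k‖ ^ 2
        + (384 * (ε * (((F.L : ℝ) ^ (K - n)) ^ 2)⁻¹) ^ 2 + 60 * s ^ 2 + 12 * (ε * (((F.L : ℝ) ^ (K - n)) ^ 2)⁻¹)) * ∑ b : PBond (F.P K) 0, ‖X b‖ ^ 2 := by
  have h := cellGrad_Y0_le_of_regPr_T3 F n K hN y hε hreg X hX hs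
  calc _ = ∑ t : Fin (F.P K).d → Fin N₀, ∑ μ : Fin (F.P K).d, ∑ ν : Fin (F.P K).d,
        ‖conjR (pull (bgUnits F K W) y (boxVec N₀ t) ν)
            (((pull (fun b => expUnit (Complex.I • X b)) y (boxVec N₀ t + e ν) μ : (Matrix (Fin 2) (Fin 2) ℂ)ˣ) : Matrix (Fin 2) (Fin 2) ℂ) - 1)
          - (((pull (fun b => expUnit (Complex.I • X b)) y (boxVec N₀ t) μ : (Matrix (Fin 2) (Fin 2) ℂ)ˣ) : Matrix (Fin 2) (Fin 2) ℂ) - 1)‖ ^ 2 :=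
          Finset.sum_congr rfl fun t _ => Finset.sum_comm
    _ ≤ _ := h

/-- The ν-OUTER edition of `cellGrad_tildIter_zero_le_of_regPr_T3` (F-6d-3's `GRADc 0` order, datum in `hMc`'s `tildIter … 0` letter). [cite: Balaban1985Averaging, (69) p.29;
Balaban1985Variational, (135) p.298] -/
theorem cellGrad_tildIter_zero_le_of_regPr_T3_comm {N₀ : ℕ} (hN : (F.P K).sitesPerDir 0 = N₀) (y : Site (F.P K) 0) {ε s : ℝ} (hε : 0 ≤ ε)
    {W : GaugeField (F.P K) 0 (Matrix.specialUnitaryGroup (Fin 2) ℂ)} (hreg : RegPr F n K ε W)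
    (X : PBond (F.P K) 0 → Matrix (Fin 2) (Fin 2) ℂ) (hX : ∀ b : PBond (F.P K) 0, (X b).IsHermitian ∧ Matrix.trace (X b) = 0)
    (hs : ∀ b : PBond (F.P K) 0, ‖X b‖ ≤ s) :
    ∑ t : Fin (F.P K).d → Fin N₀, ∑ ν : Fin (F.P K).d, ∑ μ : Fin (F.P K).d,
        ‖conjR (pull (bgUnits F K W) y (boxVec N₀ t) ν)
            (((tildIter (F.P K).L (pull (bgUnits F K W) y) (pull (fun b => expUnit (Complex.I • X b)) y) 0 (boxVec N₀ t + e ν) μ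
                : (Matrix (Fin 2) (Fin 2) ℂ)ˣ) : Matrix (Fin 2) (Fin 2) ℂ) - 1)
          - (((tildIter (F.P K).L (pull (bgUnits F K W) y) (pull (fun b => expUnit (Complex.I • X b)) y) 0 (boxVec N₀ t) μ
                : (Matrix (Fin 2) (Fin 2) ℂ)ˣ) : Matrix (Fin 2) (Fin 2) ℂ) - 1)‖ ^ 2
      ≤ 8 * (∑ p : Plaq (F.P K) 0, ‖((Complex.I • X ⟨p.src, p.μ⟩)
          + ((W ⟨p.src, p.μ⟩ : Matrix (Fin 2) (Fin 2) ℂ) * (Complex.I • X ⟨p.src.shift p.μ, p.ν⟩) * star (W ⟨p.src, p.μ⟩ : Matrix (Fin 2) (Fin 2) ℂ))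
          - (((W ⟨p.src, p.μ⟩ * W ⟨p.src.shift p.μ, p.ν⟩ * (W ⟨p.src.shift p.ν, p.μ⟩)⁻¹ : Matrix.specialUnitaryGroup (Fin 2) ℂ) : Matrix (Fin 2) (Fin 2) ℂ)
              * (Complex.I • X ⟨p.src.shift p.ν, p.μ⟩)
              * star ((W ⟨p.src, p.μ⟩ * W ⟨p.src.shift p.μ, p.ν⟩ * (W ⟨p.src.shift p.ν, p.μ⟩)⁻¹ : Matrix.specialUnitaryGroup (Fin 2) ℂ) : Matrix (Fin 2) (Fin 2) ℂ))
          - (((GaugeField.plaqHol W p : Matrix.specialUnitaryGroup (Fin 2) ℂ) : Matrix (Fin 2) (Fin 2) ℂ) * (Complex.I • X ⟨p.src, p.ν⟩)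
              * star ((GaugeField.plaqHol W p : Matrix.specialUnitaryGroup (Fin 2) ℂ) : Matrix (Fin 2) (Fin 2) ℂ)))‖ ^ 2)
        + 2 * ∑ x : Site (F.P K) 0, ∑ j : Fin 2, ∑ k : Fin 2,
            ‖(divB (torusT (F.P K) 0) (fun κ z => unitsField (toUField W) ⟨z, κ⟩) (fun κ z => Complex.I • X ⟨z, κ⟩) x) j k‖ ^ 2
        + (384 * (ε * (((F.L : ℝ) ^ (K - n)) ^ 2)⁻¹) ^ 2 + 60 * s ^ 2 + 12 * (ε * (((F.L : ℝ) ^ (K - n)) ^ 2)⁻¹)) * ∑ b : PBond (F.P K) 0, ‖X b‖ ^ 2 := by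
  simp only [tildIter_zero']
  exact cellGrad_Y0_le_of_regPr_T3_comm F n K hN y hε hreg X hX hs

/-! ## §3 ★★ At the `hMc` datum: the windows come from `In19`, and the whole zeroth-order part sits in the `((L^{K−n})²)⁻¹·M` slot -/

/-- `η² = ((L^{K−n})²)⁻¹` (`η = eta F n K = (L⁻¹)^{K−n}`). [cite: Balaban1985Variational, (2) and (5) p.278] -/
theorem eta_sq_eq : eta F n K ^ 2 = (((F.L : ℝ) ^ (K - n)) ^ 2)⁻¹ := by
  rw [eta, ← pow_mul, inv_pow, pow_mul]

/-- `((L^{K−n})²)⁻¹ ≤ 1` (`L > 1`). [cite: Balaban1985Variational, (2) p.278] -/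
theorem inv_ell_sq_le_one : (((F.L : ℝ) ^ (K - n)) ^ 2)⁻¹ ≤ 1 := by
  have h1 : (1 : ℝ) ≤ (F.L : ℝ) := by exact_mod_cast F.hL.2.le
  exact inv_le_one_of_one_le₀ (one_le_pow₀ (one_le_pow₀ h1))

/-- ★★ **`GRADcov₀` AT THE `hMc` DATUM** — the windows are read off `In19 F n K δ W U₁ X` ([Balaban1985Variational] (19): `X` Hermitian traceless, `‖X b‖ < δ·η`) and `RegPr F n K ε W`
(plaquettes within `ε·((L^{K−n})²)⁻¹`), and the entire zeroth-order part lands in `hMc`'s `B′·((L^{K−n})²)⁻¹·Σ_b‖X b‖²` slot: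
`GRADcov₀(Y₀) ≤ 8·K_W(iX) + 2·DIV_W(iX) + (384ε² + 12ε + 60δ²)·((L^{K−n})²)⁻¹·Σ_b‖X b‖²` (cell socket in F-8c-1's `Σ_t Σ_μ Σ_ν` shape; any base `y`, any name `N₀`).
[cite: Balaban1985Variational, (2) p.278, (15) p.280, (19) p.281, (47)-(48) pp.285-286, (135) p.298; Balaban1985BackgroundPropagators, (3.4)-(3.8) pp.391-392] -/
theorem cellGrad_Y0_le_of_regPr_of_in19_T3 {N₀ : ℕ} (hN : (F.P K).sitesPerDir 0 = N₀) (y : Site (F.P K) 0) {ε δ : ℝ} (hε : 0 ≤ ε)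
    {W U₁ : GaugeField (F.P K) 0 (Matrix.specialUnitaryGroup (Fin 2) ℂ)} (hreg : RegPr F n K ε W)
    {X : PBond (F.P K) 0 → Matrix (Fin 2) (Fin 2) ℂ} (h19 : In19 F n K δ W U₁ X) :
    ∑ t : Fin (F.P K).d → Fin N₀, ∑ μ : Fin (F.P K).d, ∑ ν : Fin (F.P K).d,
        ‖conjR (pull (bgUnits F K W) y (boxVec N₀ t) ν)
            (((pull (fun b => expUnit (Complex.I • X b)) y (boxVec N₀ t + e ν) μ : (Matrix (Fin 2) (Fin 2) ℂ)ˣ) : Matrix (Fin 2) (Fin 2) ℂ) - 1)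
          - (((pull (fun b => expUnit (Complex.I • X b)) y (boxVec N₀ t) μ : (Matrix (Fin 2) (Fin 2) ℂ)ˣ) : Matrix (Fin 2) (Fin 2) ℂ) - 1)‖ ^ 2
      ≤ 8 * (∑ p : Plaq (F.P K) 0, ‖((Complex.I • X ⟨p.src, p.μ⟩)
          + ((W ⟨p.src, p.μ⟩ : Matrix (Fin 2) (Fin 2) ℂ) * (Complex.I • X ⟨p.src.shift p.μ, p.ν⟩) * star (W ⟨p.src, p.μ⟩ : Matrix (Fin 2) (Fin 2) ℂ))
          - (((W ⟨p.src, p.μ⟩ * W ⟨p.src.shift p.μ, p.ν⟩ * (W ⟨p.src.shift p.ν, p.μ⟩)⁻¹ : Matrix.specialUnitaryGroup (Fin 2) ℂ) : Matrix (Fin 2) (Fin 2) ℂ)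
              * (Complex.I • X ⟨p.src.shift p.ν, p.μ⟩)
              * star ((W ⟨p.src, p.μ⟩ * W ⟨p.src.shift p.μ, p.ν⟩ * (W ⟨p.src.shift p.ν, p.μ⟩)⁻¹ : Matrix.specialUnitaryGroup (Fin 2) ℂ) : Matrix (Fin 2) (Fin 2) ℂ))
          - (((GaugeField.plaqHol W p : Matrix.specialUnitaryGroup (Fin 2) ℂ) : Matrix (Fin 2) (Fin 2) ℂ) * (Complex.I • X ⟨p.src, p.ν⟩)
              * star ((GaugeField.plaqHol W p : Matrix.specialUnitaryGroup (Fin 2) ℂ) : Matrix (Fin 2) (Fin 2) ℂ)))‖ ^ 2)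
        + 2 * ∑ x : Site (F.P K) 0, ∑ j : Fin 2, ∑ k : Fin 2,
            ‖(divB (torusT (F.P K) 0) (fun κ z => unitsField (toUField W) ⟨z, κ⟩) (fun κ z => Complex.I • X ⟨z, κ⟩) x) j k‖ ^ 2
        + (384 * ε ^ 2 + 12 * ε + 60 * δ ^ 2) * (((F.L : ℝ) ^ (K - n)) ^ 2)⁻¹ * ∑ b : PBond (F.P K) 0, ‖X b‖ ^ 2 := by
  have hX := h19.1
  have hs : ∀ b : PBond (F.P K) 0, ‖X b‖ ≤ δ * eta F n K := fun b => (h19.2.2.1 b).le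
  have h := cellGrad_Y0_le_of_regPr_T3 F n K hN y hε hreg X hX hs
  have hq0 : 0 ≤ (((F.L : ℝ) ^ (K - n)) ^ 2)⁻¹ := by positivity
  have hq1 := inv_ell_sq_le_one F n K
  have hη : (δ * eta F n K) ^ 2 = δ ^ 2 * (((F.L : ℝ) ^ (K - n)) ^ 2)⁻¹ := by rw [mul_pow, eta_sq_eq]
  have hM : 0 ≤ ∑ b : PBond (F.P K) 0, ‖X b‖ ^ 2 := Finset.sum_nonneg fun _ _ => sq_nonneg _
  have hcoef : 384 * (ε * (((F.L : ℝ) ^ (K - n)) ^ 2)⁻¹) ^ 2 + 60 * (δ * eta F n K) ^ 2 + 12 * (ε * (((F.L : ℝ) ^ (K - n)) ^ 2)⁻¹)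
      ≤ (384 * ε ^ 2 + 12 * ε + 60 * δ ^ 2) * (((F.L : ℝ) ^ (K - n)) ^ 2)⁻¹ := by
    rw [hη]
    have hε2 : 0 ≤ ε ^ 2 := sq_nonneg ε
    nlinarith [mul_le_mul_of_nonneg_left (mul_le_one₀ hq1 hq0 hq1) (mul_nonneg (by norm_num : (0:ℝ) ≤ 384) hε2), hq0, sq_nonneg δ]
  have hfin := mul_le_mul_of_nonneg_right hcoef hM
  linarith [h, hfin]

/-- ★★ **THE SAME IN `hMc`'s OWN TOWER LETTER AT LEVEL 0** (`Ũ⁰ = tildIter L U₀♯ U₁♯ 0 = U₁♯`): `GRADcov₀(Ũ⁰ − 1) ≤ 8·K_W(iX) + 2·DIV_W(iX) + (384ε² + 12ε + 60δ²)·((L^{K−n})²)⁻¹·Σ_b‖X b‖²`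
under `RegPr F n K ε W` and `In19 F n K δ W U₁ X`. [cite: Balaban1985Averaging, (69) p.29; Balaban1985Variational, (2) p.278, (19) p.281, (135) p.298] -/
theorem cellGrad_tildIter_zero_le_of_regPr_of_in19_T3 {N₀ : ℕ} (hN : (F.P K).sitesPerDir 0 = N₀) (y : Site (F.P K) 0) {ε δ : ℝ} (hε : 0 ≤ ε)
    {W U₁ : GaugeField (F.P K) 0 (Matrix.specialUnitaryGroup (Fin 2) ℂ)} (hreg : RegPr F n K ε W)
    {X : PBond (F.P K) 0 → Matrix (Fin 2) (Fin 2) ℂ} (h19 : In19 F n K δ W U₁ X) :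
    ∑ t : Fin (F.P K).d → Fin N₀, ∑ μ : Fin (F.P K).d, ∑ ν : Fin (F.P K).d,
        ‖conjR (pull (bgUnits F K W) y (boxVec N₀ t) ν)
            (((tildIter (F.P K).L (pull (bgUnits F K W) y) (pull (fun b => expUnit (Complex.I • X b)) y) 0 (boxVec N₀ t + e ν) μ
                : (Matrix (Fin 2) (Fin 2) ℂ)ˣ) : Matrix (Fin 2) (Fin 2) ℂ) - 1)
          - (((tildIter (F.P K).L (pull (bgUnits F K W) y) (pull (fun b => expUnit (Complex.I • X b)) y) 0 (boxVec N₀ t) μ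
                : (Matrix (Fin 2) (Fin 2) ℂ)ˣ) : Matrix (Fin 2) (Fin 2) ℂ) - 1)‖ ^ 2
      ≤ 8 * (∑ p : Plaq (F.P K) 0, ‖((Complex.I • X ⟨p.src, p.μ⟩)
          + ((W ⟨p.src, p.μ⟩ : Matrix (Fin 2) (Fin 2) ℂ) * (Complex.I • X ⟨p.src.shift p.μ, p.ν⟩) * star (W ⟨p.src, p.μ⟩ : Matrix (Fin 2) (Fin 2) ℂ))
          - (((W ⟨p.src, p.μ⟩ * W ⟨p.src.shift p.μ, p.ν⟩ * (W ⟨p.src.shift p.ν, p.μ⟩)⁻¹ : Matrix.specialUnitaryGroup (Fin 2) ℂ) : Matrix (Fin 2) (Fin 2) ℂ)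
              * (Complex.I • X ⟨p.src.shift p.ν, p.μ⟩)
              * star ((W ⟨p.src, p.μ⟩ * W ⟨p.src.shift p.μ, p.ν⟩ * (W ⟨p.src.shift p.ν, p.μ⟩)⁻¹ : Matrix.specialUnitaryGroup (Fin 2) ℂ) : Matrix (Fin 2) (Fin 2) ℂ))
          - (((GaugeField.plaqHol W p : Matrix.specialUnitaryGroup (Fin 2) ℂ) : Matrix (Fin 2) (Fin 2) ℂ) * (Complex.I • X ⟨p.src, p.ν⟩)
              * star ((GaugeField.plaqHol W p : Matrix.specialUnitaryGroup (Fin 2) ℂ) : Matrix (Fin 2) (Fin 2) ℂ)))‖ ^ 2)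
        + 2 * ∑ x : Site (F.P K) 0, ∑ j : Fin 2, ∑ k : Fin 2,
            ‖(divB (torusT (F.P K) 0) (fun κ z => unitsField (toUField W) ⟨z, κ⟩) (fun κ z => Complex.I • X ⟨z, κ⟩) x) j k‖ ^ 2
        + (384 * ε ^ 2 + 12 * ε + 60 * δ ^ 2) * (((F.L : ℝ) ^ (K - n)) ^ 2)⁻¹ * ∑ b : PBond (F.P K) 0, ‖X b‖ ^ 2 := by
  simp only [tildIter_zero']
  exact cellGrad_Y0_le_of_regPr_of_in19_T3 F n K hN y hε hreg h19

/-- **THE LEVEL-0 CELL MASS AT THE DATUM**: `Σ_tΣ_μ ‖↑U₁♯ − 1‖² ≤ Σ_b‖X b‖²` from `In19`'s first conjunct alone. [cite: Balaban1985Averaging, (24) p.21; Balaban1985Variational, (19) p.281] -/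
theorem cellMass_Y0_le_of_in19_T3 {N₀ : ℕ} (hN : (F.P K).sitesPerDir 0 = N₀) (y : Site (F.P K) 0) {δ : ℝ}
    {W U₁ : GaugeField (F.P K) 0 (Matrix.specialUnitaryGroup (Fin 2) ℂ)} {X : PBond (F.P K) 0 → Matrix (Fin 2) (Fin 2) ℂ} (h19 : In19 F n K δ W U₁ X) :
    ∑ t : Fin (F.P K).d → Fin N₀, ∑ μ : Fin (F.P K).d,
        ‖((pull (fun b => expUnit (Complex.I • X b)) y (boxVec N₀ t) μ : (Matrix (Fin 2) (Fin 2) ℂ)ˣ) : Matrix (Fin 2) (Fin 2) ℂ) - 1‖ ^ 2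
      ≤ ∑ b : PBond (F.P K) 0, ‖X b‖ ^ 2 :=
  cellMass_Y0_le_T3 F K hN y W X h19.1

end T3

end Summit.QuantumFields.YangMills.Theorems.Prop7CombCellLevelZeroCurrencyT3

end
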